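import Summits.QuantumFields.YangMills.Theorems.UnitScaleTiltProp8IterPlaqSmall
import HarnessLib

/-!
# Route `UnitScaleTilt`, crux K1 «MinimiserStabilityRegPr» (stmt-QuantumFields-19200), leaf V2′ `stub_halvingStep` — sub-lemma P0 (ii):
# **THE MULTI-LEVEL DATA OF A CONFIGURATION OF (6)(ε₀) READ THROUGH FINE CONTOURS — k-UNIFORM, GAUGE-FREE FORM OF
# [Balaban1985Variational] (145)/(151)**

Cell `ym3-torus` ∕ fleet seat `ym-ust-19200-p2` g5; third file of the sitting (files 1–2: `…IterTransport` p531012, `…IterPlaqSmall`).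
WHY.  Print's localisation (144)–(151) feeds [Balaban1985RegularSpaces] Thm 2 with the multi-level data `V″ = (U′_k)‾ʲ` of the axially gauged
minimiser and the closeness «|V″ − 1| < 9dL²Mε₀ on ℭ_k» (151), obtained from (145) «|U′_k(x,x′) − 1| < |x − y|2L²ε₀» (axial gauge centred at
`y`, plaquettes `< ε₀η²`).  In the tree the axial gauge transformation based at `y₀` is `v(x) = U(Γ_{y₀,x})` (`B10Eq27TorusAxialLog.axialT`, a
holonomy `holAt U (walk y₀ Γ)` by `holT_eq_holAt`), so the level-`i` datum in that gauge is `v(x₋)·Ū^{(i)}(c)·v(x₊)⁻¹` with `x_± =` the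
iterated block centres of `c_±`.  THIS FILE bounds `dist1` of that product for ARBITRARY fine contours `Γ₁` (to `x₋`) and `Γ₂` (to `x₊`):
`dist1(U(Γ₁)·Ū^{(i)}(c)·U(Γ₂)⁻¹) ≤ B·L^{2i}·a + ((|Γ₁| + Lⁱ + |Γ₂|)²/4)·a` whenever every fine plaquette variable is within `a` of `1` and the
word `Γ₁ ++ (+e_μ)^{Lⁱ} ++ Γ₂⁻¹` is closed — uniformly in `i ≤ k` and in the volume (`B` from file 2's domination condition; `B = 100` for `L ≥ 7`
at `d = 3`).  With the comb contours of the axial gauge (`|Γ| ≤ d·M·Lᵏ` inside a cube of radius `M` unit blocks) and `a = ε₀L^{−2k}` this is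
print's `O(d²L⁰M²)·ε₀` (our square replaces print's `|x − y|·2L²` because the crude word-Stokes bound is quadratic in the length; harmless:
`M = R₁M₁` is fixed before `a₅`).

THE ARGUMENT.  `U(Γ₁)·Ū^{(i)}(c)·U(Γ₂)⁻¹ = [U(Γ₁)·(Ū^{(i)}(c)·U(seg)⁻¹)·U(Γ₁)⁻¹]·U(Γ₁ ++ seg ++ Γ₂⁻¹)` with `seg` the straight refinement of `c`
(`Lⁱ` fine steps from `x₋`): the first factor is file 1's transport comparison at the single letter `+e_μ` (`≤ τ_i = B·L^{2i}·a` by file 2's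
correction-factor bounds), the second a CLOSED fine word (`LatticeWordStokes.dist1_holAt_le`).  The fine base points are handled through ANY
family `e i : T^{(i)} → T^{(0)}` with `e 0 = id`, `e (i+1) = e i ∘ emb` (the iterated block centre; a hypothesis, so no definition is introduced):
§1 `walkEnd (e i y) (refineⁱ w) = e i (walkEnd y w)`; §2 the POINTED transport comparison `dist1_holAt_iter_mul_inv_le_at` (file 1's
`dist1_holAt_iter_mul_inv_le` with the base point named); §3 the contour bound `dist1_contour_iter_le`; §4 the d = 3 carrier form with
`a = ε₀L^{−2(K−n)}`, `B = 100`, `L ≥ 7`.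
HONEST SCOPE.  Elementary; `L ∈ {3,5}` excluded as in file 2; the choice of contours (combs, no wrap-around inside the cube) and the resulting
`9dL²Mε₀`-type constant are the consumer's (pillar P0/P1 of the v8 re-cut).  Sorry-free, definition-free.  NOT a claim about the mass gap.

References: T. Bałaban, CMP **102** (1985) 277–309 [Balaban1985Variational] ((145)–(151) p.301); CMP **98** (1985) 17–51 [Balaban1985Averaging]
((19)–(20) p.21, the comb contours p.24); CMP **109** (1987) 249–301 [Balaban1987RG1] ((0.4), (0.11) p.253).
-/

noncomputable section

open scoped BigOperators

namespace Summit.QuantumFields.YangMills.Theorems.IterPlaqSmall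

open Literature.MathematicalPhysics.QuantumFieldTheory.Balaban1983to89
open T4Continuum T4ReflectionCone BlockAveraging ExpMeanLog LatticeWordStokes BlockAveragingPlaquetteBound

/-! ## §1 Iterated block centres (as a hypothesis family) and refined walks -/

section Centres

variable {P : Params} {j : ℕ}

/-- The refined walk from the block centre ends at the block centre of the end of the coarse walk. [cite: Balaban1987RG1, (0.3) p.252] -/
theorem walkEnd_emb_flatMap_replicate : ∀ (w : List (Letter P.d)) (y : Site P (j + 1)),
    walkEnd (emb y) (w.flatMap (fun l => List.replicate P.L l)) = emb (walkEnd y w)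
  | [], y => rfl
  | (μ, true) :: w, y => by
    rw [List.flatMap_cons, walkEnd_append, walkEnd_replicate_L, walkEnd_emb_flatMap_replicate w]
    rfl
  | (μ, false) :: w, y => by
    rw [List.flatMap_cons, walkEnd_append, walkEnd_replicate_L_false, walkEnd_emb_flatMap_replicate w]
    rfl

/-- For any family of ITERATED BLOCK CENTRES `e i : T^{(i)} → T^{(0)}` (`e 0 = id`, `e (i+1) = e i ∘ emb`): the `i`-fold refined walk from `e i y`
ends at `e i` of the end of the level-`i` walk. [cite: Balaban1987RG1, (0.3) p.252] -/
theorem walkEnd_iterate_flatMap_replicate (e : (i : ℕ) → Site P i → Site P 0) (he0 : ∀ y, e 0 y = y)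
    (hes : ∀ (i : ℕ) (y : Site P (i + 1)), e (i + 1) y = e i (emb y)) :
    ∀ (i : ℕ) (w : List (Letter P.d)) (y : Site P i),
      walkEnd (e i y) ((fun w : List (Letter P.d) => w.flatMap (fun l => List.replicate P.L l))^[i] w) = e i (walkEnd y w)
  | 0, w, y => by simp [he0]
  | i + 1, w, y => by
    rw [Function.iterate_succ_apply, hes, walkEnd_iterate_flatMap_replicate e he0 hes i, walkEnd_emb_flatMap_replicate, hes]

end Centres

/-! ## §2 The pointed transport comparison -/

section Pointed

variable {P : Params} {G : Type*} [GaugeGroup G]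

/-- **`i` STEPS, BASE POINT NAMED** (file 1's `dist1_holAt_iter_mul_inv_le` with the fine base point `e i y`): under level-wise bounds `κ_{i'}`
(`i' < k`) on the correction factors and a super-solution `τ` (`0 ≤ τ₀`, `κ_i + Lτ_i ≤ τ_{i+1}`), for `i ≤ k` and every level-`i` walk `w` from `y`:
`dist1(Ū^{(i)}(w)·U(refineⁱ w from e i y)⁻¹) ≤ |w|·τ_i`. [cite: Balaban1987RG1, (0.4) and (0.11) p.253; Balaban1985Averaging, (19)-(20) p.21] -/
theorem dist1_holAt_iter_mul_inv_le_at (e : (i : ℕ) → Site P i → Site P 0) (he0 : ∀ y, e 0 y = y)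
    (hes : ∀ (i : ℕ) (y : Site P (i + 1)), e (i + 1) y = e i (emb y))
    (ℰ : LoopAverage G) (U : GaugeField P 0 G) (k : ℕ) {κ τ : ℕ → ℝ} (hκ0 : ∀ i, 0 ≤ κ i)
    (hτ0 : 0 ≤ τ 0) (hτ : ∀ i, κ i + (P.L : ℝ) * τ i ≤ τ (i + 1))
    (hκ : ∀ i, i < k → ∀ c : PBond P (i + 1), dist1 (corr ℰ (Averaging.iter (fun j => blockAvg (P := P) (j := j) ℰ) i U) c) ≤ κ i) :
    ∀ i, i ≤ k → ∀ (w : List (Letter P.d)) (y : Site P i),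
      dist1 (holAt (Averaging.iter (fun j => blockAvg (P := P) (j := j) ℰ) i U) (walk y w) *
        (holAt U (walk (e i y) ((fun w : List (Letter P.d) => w.flatMap (fun l => List.replicate P.L l))^[i] w)))⁻¹) ≤ w.length * τ i
  | 0, _, w, y => by
    simp only [Function.iterate_zero, id_eq, he0]
    show dist1 (holAt U (walk y w) * (holAt U (walk y w))⁻¹) ≤ w.length * τ 0
    rw [mul_inv_cancel, GaugeGroup.dist1_one]
    positivity
  | i + 1, hi, w, y => by
    have hik : i < k := Nat.lt_of_succ_le hi
    have h1 := dist1_holAt_avgFun_mul_inv_le ℰ (Averaging.iter (fun j => blockAvg (P := P) (j := j) ℰ) i U) (hκ0 i) (hκ i hik) w y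
    have h2 := dist1_holAt_iter_mul_inv_le_at e he0 hes ℰ U k hκ0 hτ0 hτ hκ i hik.le (w.flatMap (fun l => List.replicate P.L l)) (emb y)
    rw [iter_succ_eq, Function.iterate_succ_apply, hes]
    refine (B15.PrelimIntegrations.dist1_fluct_le _ _ _).trans ((add_le_add h1 h2).trans ?_)
    rw [length_flatMap_replicate, Nat.cast_mul]
    have hlen : (0 : ℝ) ≤ w.length := Nat.cast_nonneg _
    have := hτ i
    nlinarith [mul_le_mul_of_nonneg_left this hlen]

end Pointed

/-! ## §3 The contour bound -/

section Contour

open scoped Matrix.Norms.L2Operator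

variable {n : Type*} [Fintype n] [DecidableEq n] [Nonempty n] {P : Params}

/-- **THE LEVEL-`i` DATUM READ THROUGH FINE CONTOURS** (`ℓ = (d+2)L`; hypotheses of file 2's `dist1_corr_iter_le`): for `i ≤ k`, a level-`i` bond
`c = ⟨z, z + e_μ⟩`, a fine base point `y₀` and fine words `Γ₁`, `Γ₂` from `y₀` ending at the iterated block centres `e i z`, `e i (z + e_μ)` with
`Γ₁ ++ (+e_μ)^{Lⁱ} ++ Γ₂⁻¹` closed:
`dist1(U(Γ₁)·Ū^{(i)}(c)·U(Γ₂)⁻¹) ≤ B·L^{2i}·a + ((|Γ₁| + Lⁱ + |Γ₂|)²/4)·a`. [cite: Balaban1985Variational, (145) and (151) p.301] -/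
theorem dist1_contour_iter_le (e : (i : ℕ) → Site P i → Site P 0) (he0 : ∀ y, e 0 y = y)
    (hes : ∀ (i : ℕ) (y : Site P (i + 1)), e (i + 1) y = e i (emb y))
    (U : GaugeField P 0 (Matrix.specialUnitaryGroup n ℂ)) {a : ℝ} (ha : 0 ≤ a) (hU : PlaqSmall a U) (k : ℕ)
    {B : ℝ} (hB0 : 0 ≤ B)
    (hB : 21 / 20 * ((((P.d + 2) * P.L : ℕ) : ℝ)) * B + 21 / 20 * (((((P.d + 2) * P.L : ℕ) : ℝ)) ^ 2 / 4) + (P.L : ℝ) * B ≤ B * (P.L : ℝ) ^ 2)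
    (hsmall : (((((P.d + 2) * P.L : ℕ) : ℝ)) * B + ((((P.d + 2) * P.L : ℕ) : ℝ)) ^ 2 / 4) * (P.L : ℝ) ^ (2 * k) * a ≤ 1 / 50)
    (hδ : (1 : ℝ) / 50 < deltaSU n)
    {i : ℕ} (hik : i ≤ k) (c : PBond P i) (y₀ : Site P 0) (Γ₁ Γ₂ : List (Letter P.d))
    (hΓ₁ : walkEnd y₀ Γ₁ = e i c.src) (hΓ₂ : walkEnd y₀ Γ₂ = e i c.tgt)
    (hclosed : ∀ ν, netDisp Γ₁ ν + (if c.dir = ν then ((P.L ^ i : ℕ) : ℤ) else 0) - netDisp Γ₂ ν = 0) :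
    dist1 (holAt U (walk y₀ Γ₁) * Averaging.iter (fun j => blockAvg (P := P) (j := j) (expMeanLogSU (n := n))) i U c *
        (holAt U (walk y₀ Γ₂))⁻¹) ≤
      B * (P.L : ℝ) ^ (2 * i) * a + (((Γ₁.length : ℝ) + (P.L : ℝ) ^ i + (Γ₂.length : ℝ)) ^ 2 / 4) * a := by
  set ℓ : ℝ := (((P.d + 2) * P.L : ℕ) : ℝ) with hℓ_def
  have hℓ0 : 0 ≤ ℓ := Nat.cast_nonneg _
  have hL1 : (1 : ℝ) ≤ (P.L : ℝ) := by exact_mod_cast P.L_pos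
  have hL0 : (0 : ℝ) ≤ (P.L : ℝ) := zero_le_one.trans hL1
  have hκ0 : ∀ i, 0 ≤ 21 / 20 * ((ℓ * B + ℓ ^ 2 / 4) * (P.L : ℝ) ^ (2 * i) * a) := fun i => by positivity
  have hτ0 : 0 ≤ B * (P.L : ℝ) ^ (2 * 0) * a := by positivity
  have hτ : ∀ i, 21 / 20 * ((ℓ * B + ℓ ^ 2 / 4) * (P.L : ℝ) ^ (2 * i) * a) + (P.L : ℝ) * (B * (P.L : ℝ) ^ (2 * i) * a) ≤
      B * (P.L : ℝ) ^ (2 * (i + 1)) * a := superSolution_of_dominated hL0 ha hB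
  have hκ := dist1_corr_iter_le U ha hU k hB0 hB hsmall hδ
  -- the straight refinement of the coarse bond and the transport comparison at the single letter `+e_μ`
  set V := Averaging.iter (fun j => blockAvg (P := P) (j := j) (expMeanLogSU (n := n))) i U with hV_def
  set seg := (fun w : List (Letter P.d) => w.flatMap (fun l => List.replicate P.L l))^[i] [(c.dir, true)] with hseg_def
  have htrans := dist1_holAt_iter_mul_inv_le_at e he0 hes (expMeanLogSU (n := n)) U k hκ0 hτ0 hτ hκ i hik [(c.dir, true)] c.src
  have hVc : holAt V (walk c.src [(c.dir, true)]) = V c := by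
    simp only [walk, holAt_cons, holAt_nil, ↓reduceIte, mul_one]
  rw [hVc] at htrans
  simp only [List.length_singleton, Nat.cast_one, one_mul] at htrans
  -- the closed fine word `Γ₁ ++ seg ++ Γ₂⁻¹`
  set S := holAt U (walk (e i c.src) seg) with hS_def
  have hsegEnd : walkEnd (e i c.src) seg = e i c.tgt := by
    rw [hseg_def, walkEnd_iterate_flatMap_replicate e he0 hes]
    rfl
  have hword : holAt U (walk y₀ Γ₁) * S * (holAt U (walk y₀ Γ₂))⁻¹ = holAt U (walk y₀ (Γ₁ ++ seg ++ wordRev Γ₂)) := by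
    rw [walk_append, holAt_append, walk_append, holAt_append, walkEnd_append, hΓ₁, hsegEnd, ← hΓ₂, holAt_walk_wordRev]
  have hclosed' : ∀ ν, netDisp (Γ₁ ++ seg ++ wordRev Γ₂) ν = 0 := by
    intro ν
    have h := hclosed ν
    rw [netDisp_append, netDisp_append, netDisp_wordRev, hseg_def, netDisp_iterate_flatMap_replicate]
    have hsingle : netDisp [(c.dir, true)] ν = if c.dir = ν then 1 else 0 := by
      simp [netDisp]
    rw [hsingle]
    by_cases hν : c.dir = ν
    · rw [if_pos hν] at h ⊢
      push_cast at h ⊢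
      linarith
    · rw [if_neg hν] at h ⊢
      linarith
  have hlen : ((Γ₁ ++ seg ++ wordRev Γ₂).length : ℝ) = (Γ₁.length : ℝ) + (P.L : ℝ) ^ i + (Γ₂.length : ℝ) := by
    rw [List.length_append, List.length_append, hseg_def, length_iterate_flatMap_replicate]
    simp [wordRev]
  have hstokes := dist1_holAt_le U ha hU (Γ₁ ++ seg ++ wordRev Γ₂) hclosed' y₀
  rw [hlen] at hstokes
  -- insert the comparison: `G₁ V(c) G₂⁻¹ = G₁ (V(c) S⁻¹) G₁⁻¹ · (G₁ S G₂⁻¹)`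
  have hsplit : holAt U (walk y₀ Γ₁) * V c * (holAt U (walk y₀ Γ₂))⁻¹ =
      holAt U (walk y₀ Γ₁) * (V c * S⁻¹) * (holAt U (walk y₀ Γ₁))⁻¹ * (holAt U (walk y₀ Γ₁) * S * (holAt U (walk y₀ Γ₂))⁻¹) := by
    group
  rw [hsplit]
  calc dist1 (holAt U (walk y₀ Γ₁) * (V c * S⁻¹) * (holAt U (walk y₀ Γ₁))⁻¹ * (holAt U (walk y₀ Γ₁) * S * (holAt U (walk y₀ Γ₂))⁻¹))
      ≤ dist1 (holAt U (walk y₀ Γ₁) * (V c * S⁻¹) * (holAt U (walk y₀ Γ₁))⁻¹) + dist1 (holAt U (walk y₀ Γ₁) * S * (holAt U (walk y₀ Γ₂))⁻¹) :=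
        GaugeGroup.dist1_mul_le _ _
    _ = dist1 (V c * S⁻¹) + dist1 (holAt U (walk y₀ (Γ₁ ++ seg ++ wordRev Γ₂))) := by rw [GaugeGroup.dist1_conj, hword]
    _ ≤ B * (P.L : ℝ) ^ (2 * i) * a + (((Γ₁.length : ℝ) + (P.L : ℝ) ^ i + (Γ₂.length : ℝ)) ^ 2 / 4) * a := add_le_add htrans hstokes

end Contour

/-! ## §4 At the d = 3 carrier -/

section T3

open scoped Matrix.Norms.L2Operator
open T3ContinuumYM3Torus T3RegularMinimiser

/-- **(145)/(151) AT THE d = 3 CARRIER, GAUGE-FREE** (run `K`, comparison height `n`, `k = K − n`, `L ≥ 7`, `0 < ε₀`, `50(500L + 7L²)ε₀ ≤ 1`): for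
`U` with every plaquette variable within `ε₀L^{−2(K−n)}` of `1`, every `i ≤ K − n`, every level-`i` bond `c` and all fine contours `Γ₁`, `Γ₂` from `y₀`
to the iterated block centres of `c_∓` closing `Γ₁ ++ (+e_μ)^{Lⁱ} ++ Γ₂⁻¹`:
`dist1(U(Γ₁)·Ū^{(i)}(c)·U(Γ₂)⁻¹) ≤ (100·L^{2i} + (|Γ₁| + Lⁱ + |Γ₂|)²/4)·ε₀L^{−2(K−n)}`. [cite: Balaban1985Variational, (145) and (151) p.301] -/
theorem dist1_contour_iter_le_T3 (F : T3Family) (n K : ℕ) (hL : 7 ≤ F.L) {ε₀ : ℝ} (hε₀ : 0 < ε₀)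
    (hε : 50 * (500 * (F.L : ℝ) + 7 * (F.L : ℝ) ^ 2) * ε₀ ≤ 1)
    (e : (i : ℕ) → Site (F.P K) i → Site (F.P K) 0) (he0 : ∀ y, e 0 y = y)
    (hes : ∀ (i : ℕ) (y : Site (F.P K) (i + 1)), e (i + 1) y = e i (emb y))
    (U : GaugeField (F.P K) 0 (Matrix.specialUnitaryGroup (Fin 2) ℂ)) (hU : PlaqSmall (regThreshold F n K ε₀) U)
    {i : ℕ} (hik : i ≤ K - n) (c : PBond (F.P K) i) (y₀ : Site (F.P K) 0) (Γ₁ Γ₂ : List (Letter (F.P K).d))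
    (hΓ₁ : walkEnd y₀ Γ₁ = e i c.src) (hΓ₂ : walkEnd y₀ Γ₂ = e i c.tgt)
    (hclosed : ∀ ν, netDisp Γ₁ ν + (if c.dir = ν then (((F.P K).L ^ i : ℕ) : ℤ) else 0) - netDisp Γ₂ ν = 0) :
    dist1 (holAt U (walk y₀ Γ₁) * Averaging.iter (fun j => blockAvg (P := F.P K) (j := j) (expMeanLogSU (n := Fin 2))) i U c *
        (holAt U (walk y₀ Γ₂))⁻¹) ≤
      (100 * (F.L : ℝ) ^ (2 * i) + ((Γ₁.length : ℝ) + (F.L : ℝ) ^ i + (Γ₂.length : ℝ)) ^ 2 / 4) * regThreshold F n K ε₀ := by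
  have hd : (F.P K).d = 3 := T3Family.P_d F K
  have hLL : ((F.P K).L : ℝ) = F.L := rfl
  have hL0 : (0 : ℝ) < F.L := by exact_mod_cast (show 0 < F.L by omega)
  have hreg0 : 0 ≤ regThreshold F n K ε₀ := by unfold regThreshold; positivity
  have hB := dominated_T3 F K hL
  have hpow : ((F.P K).L : ℝ) ^ (2 * (K - n)) * regThreshold F n K ε₀ = ε₀ := by
    rw [hLL, regThreshold, inv_pow, mul_comm, mul_assoc, inv_mul_cancel₀ (pow_ne_zero _ hL0.ne'), mul_one]
  have hsmall : ((((((F.P K).d + 2) * (F.P K).L : ℕ) : ℝ)) * 100 + (((((F.P K).d + 2) * (F.P K).L : ℕ) : ℝ)) ^ 2 / 4) *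
      ((F.P K).L : ℝ) ^ (2 * (K - n)) * regThreshold F n K ε₀ ≤ 1 / 50 := by
    rw [mul_assoc, hpow, hd]
    push_cast
    rw [hLL]
    nlinarith
  have h := dist1_contour_iter_le e he0 hes U hreg0 hU (K - n) (by norm_num) hB hsmall one_div_fifty_lt_deltaSU_fin_two hik c y₀ Γ₁ Γ₂
    hΓ₁ hΓ₂ hclosed
  rw [hLL] at h
  refine h.trans (le_of_eq ?_)
  ring

end T3

end Summit.QuantumFields.YangMills.Theorems.IterPlaqSmall

end
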